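import Summits.ValiantsHypothesis.ValiantsHypothesis.Theorems.SymPencilIsotropicKernelDefect
import Literature.Computability.AlgebraicComplexity.AlperBogartVelascoBoxThree

/-!
# Route `SymPencil` — Lagrangian kernel rows: `im b` is invariant under `C(v) D⁻¹` for `v ∈ ker b`
# (first typed identity of the `r = 12` branch past `sdc(per_4) ≥ 25`, `--supports` stmt-ValiantsHypothesis-5674)

In the origin normal form of a symmetric determinantal representation (`Pᵀ A₀ P = 0 ⊕ D`,
`Pᵀ M(z) P = [[0, b(z)ᵀ],[b(z), C(z)]]`) the first origin moment polarised along the kernel says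
`b(z)ᵀ D⁻¹ C(v) D⁻¹ b(z') = 0` for `v ∈ ker b` (`SymPencilIsotropicKernelDefect`, step (2)).  When
the kernel rows `B = im b` are LAGRANGIAN for `⟨·, D⁻¹ ·⟩` (`|ι'| = 2 dim B`, the case `r = 12`,
`m = 25` of `per_4`, where every Hessian-rank count is void), this says exactly that the
`⟨·,D⁻¹·⟩`-selfadjoint operators `N_v = C(v) D⁻¹` (`v ∈ ker b`) PRESERVE `B`
(`mulVec_mem_range_of_lagrangian`): `C(v) D⁻¹ b(z) ∈ im b`.  Recorded as the first brick of the
non-Hessian lever asked for in the crux note NEXT-RUNG (G); nothing here bears on `VP ≠ VNP`.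
[folklore]
-/

noncomputable section

-- single-conjunct layout: Sub = Summit, duplicated namespace component intended
set_option linter.dupNamespace false

namespace Summit.ValiantsHypothesis.ValiantsHypothesis.Theorems.SymPencilLagrangianInvariant

open Matrix Module
open Summit.ValiantsHypothesis.ValiantsHypothesis.Theorems.SymPencilLagrangianKernel
open Literature.Computability.AlgebraicComplexity.AlperBogartVelasco

universe u

variable {k : Type u} [Field k] [CharZero k] {ι' : Type*} [Fintype ι'] [DecidableEq ι']
  {V : Type*} [AddCommGroup V] [Module k V]

/-- **Lagrangian kernel rows are invariant under the kernel directions**: if `im b` is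
`D⁻¹`-isotropic of half dimension and the first origin moment vanishes, then
`C(v) D⁻¹ (im b) ⊆ im b` for every `v ∈ ker b`. [folklore] -/
theorem mulVec_mem_range_of_lagrangian {D : Matrix ι' ι' k} (hD : IsUnit D.det) (hDs : Dᵀ = D)
    (b : V →ₗ[k] (ι' → k)) (C : V →ₗ[k] Matrix ι' ι' k) (hCs : ∀ z, (C z)ᵀ = C z)
    (hi : ∀ z, b z ⬝ᵥ D⁻¹ *ᵥ b z = 0)
    (hii : ∀ z, b z ⬝ᵥ (D⁻¹ * C z * D⁻¹) *ᵥ b z = 0)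
    (hL : Fintype.card ι' = 2 * Module.finrank k (LinearMap.range b))
    (v : V) (hv : b v = 0) (y : ι' → k) (hy : y ∈ LinearMap.range b) :
    C v *ᵥ (D⁻¹ *ᵥ y) ∈ LinearMap.range b := by
  classical
  have hDis : (D⁻¹)ᵀ = D⁻¹ := by rw [Matrix.transpose_nonsing_inv, hDs]
  set B := LinearMap.range b with hBdef
  -- (1) polarised isotropy on `B`
  have hsymm0 : ∀ y y' : ι' → k, y ⬝ᵥ D⁻¹ *ᵥ y' = y' ⬝ᵥ D⁻¹ *ᵥ y := fun y y' => by
    rw [dotProduct_mulVec_of_transpose_eq hDis, dotProduct_comm]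
  have hpol : ∀ y ∈ B, ∀ y' ∈ B, y ⬝ᵥ D⁻¹ *ᵥ y' = 0 := by
    rintro _ ⟨z, rfl⟩ _ ⟨z', rfl⟩
    have h := hi (z + z')
    rw [map_add, Matrix.mulVec_add, dotProduct_add, add_dotProduct, add_dotProduct, hi z, hi z',
      hsymm0 (b z') (b z), zero_add, add_zero, ← two_mul] at h
    exact (mul_eq_zero.1 h).resolve_left two_ne_zero
  -- (2) first moment along the kernel, polarised
  have hker1 : ∀ z v, b v = 0 → (D⁻¹ *ᵥ b z) ⬝ᵥ C v *ᵥ (D⁻¹ *ᵥ b z) = 0 := by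
    intro z v hv
    have h1 := hii (z + v)
    have h0 := hii z
    rw [map_add, hv, add_zero, map_add, sandwich₂_eq hDis, Matrix.add_mulVec, dotProduct_add] at h1
    rw [sandwich₂_eq hDis] at h0
    rwa [h0, zero_add] at h1
  have hsymm1 : ∀ v (p q : ι' → k), p ⬝ᵥ C v *ᵥ q = q ⬝ᵥ C v *ᵥ p := fun v p q => by
    rw [dotProduct_mulVec_of_transpose_eq (hCs v), dotProduct_comm]
  have hker2 : ∀ y ∈ B, ∀ y' ∈ B, ∀ v, b v = 0 → (D⁻¹ *ᵥ y) ⬝ᵥ C v *ᵥ (D⁻¹ *ᵥ y') = 0 := by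
    rintro _ ⟨z, rfl⟩ _ ⟨z', rfl⟩ v hv
    have h := hker1 (z + z') v hv
    rw [map_add, Matrix.mulVec_add, Matrix.mulVec_add, dotProduct_add, add_dotProduct,
      add_dotProduct, hker1 z v hv, hker1 z' v hv, hsymm1 v (D⁻¹ *ᵥ b z') (D⁻¹ *ᵥ b z), zero_add,
      add_zero, ← two_mul] at h
    exact (mul_eq_zero.1 h).resolve_left two_ne_zero
  -- (3) `B^⊥` as the kernel of the pairing with a basis of `B`, and `B' = D⁻¹ B ≤ B^⊥`
  let yB := Module.finBasis k B
  set r := Module.finrank k B with hr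
  let Y : Matrix (Fin r) ι' k := Matrix.of fun i j => (yB i : ι' → k) j
  have hYrow : ∀ i, Y i = (yB i : ι' → k) := fun i => rfl
  let Bp : Submodule k (ι' → k) := LinearMap.ker Y.mulVecLin
  have memBp : ∀ t, t ∈ Bp ↔ ∀ y ∈ B, y ⬝ᵥ t = 0 := by
    intro t
    constructor
    · intro ht y hy
      rw [LinearMap.mem_ker, Matrix.mulVecLin_apply] at ht
      have hbas : ∀ i, (yB i : ι' → k) ⬝ᵥ t = 0 := fun i => by
        have := congr_fun ht i
        rwa [Matrix.mulVec, hYrow] at this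
      let φ' : B →ₗ[k] k :=
        { toFun := fun y => (y : ι' → k) ⬝ᵥ t
          map_add' := fun y₁ y₂ => by simp only [Submodule.coe_add, add_dotProduct]
          map_smul' := fun c y => by
            simp only [Submodule.coe_smul, smul_dotProduct, smul_eq_mul, RingHom.id_apply] }
      have hφ : φ' = 0 := yB.ext fun i => by rw [LinearMap.zero_apply]; exact hbas i
      have := LinearMap.congr_fun hφ ⟨y, hy⟩
      rwa [LinearMap.zero_apply] at this
    · intro ht
      rw [LinearMap.mem_ker, Matrix.mulVecLin_apply]
      ext i
      rw [Matrix.mulVec, hYrow, Pi.zero_apply]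
      exact ht _ (yB i).2
  let B' : Submodule k (ι' → k) := Submodule.map (D⁻¹).mulVecLin B
  have memB' : ∀ t, t ∈ B' ↔ ∃ y ∈ B, t = D⁻¹ *ᵥ y := fun t => by
    constructor
    · rintro ⟨y, hy, rfl⟩; exact ⟨y, hy, rfl⟩
    · rintro ⟨y, hy, rfl⟩; exact ⟨y, hy, rfl⟩
  have hB'le : B' ≤ Bp := by
    rintro _ ⟨y', hy', rfl⟩
    rw [memBp]
    intro y hy
    exact hpol _ hy _ hy'
  have hDiu : IsUnit D⁻¹ :=
    (Matrix.isUnit_iff_isUnit_det _).2 (Matrix.isUnit_nonsing_inv_det_iff.2 hD)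
  have hinj : Function.Injective (D⁻¹).mulVecLin := Matrix.mulVec_injective_iff_isUnit.2 hDiu
  have hB'dim : Module.finrank k B' = r := (Submodule.equivMapOfInjective _ hinj B).finrank_eq.symm
  have hYrank : Y.rank = r := by
    rw [Matrix.rank_eq_finrank_span_row]
    have hrange : Set.range Y.row = B.subtype '' Set.range yB := by
      ext q
      simp only [Set.mem_range, Set.mem_image, Submodule.coe_subtype, Matrix.row, hYrow]
      constructor
      · rintro ⟨i, rfl⟩; exact ⟨yB i, ⟨i, rfl⟩, rfl⟩
      · rintro ⟨_, ⟨i, rfl⟩, rfl⟩; exact ⟨i, rfl⟩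
    rw [hrange, Submodule.span_image, yB.span_eq, Submodule.map_top, Submodule.range_subtype]
  have hBpdim : Module.finrank k Bp ≤ r := by
    have h := LinearMap.finrank_range_add_finrank_ker Y.mulVecLin
    rw [Module.finrank_fintype_fun_eq_card] at h
    change Y.rank + Module.finrank k Bp = _ at h
    omega
  -- Lagrangian: `B^⊥ = D⁻¹ B`
  have hBpeq : B' = Bp := Submodule.eq_of_le_of_finrank_le hB'le (by rw [hB'dim]; exact hBpdim)
  -- `t := D⁻¹ C(v) D⁻¹ y ∈ B^⊥` by the polarised first moment
  have ht : D⁻¹ *ᵥ (C v *ᵥ (D⁻¹ *ᵥ y)) ∈ Bp := by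
    rw [memBp]
    intro y' hy'
    rw [dotProduct_mulVec_of_transpose_eq hDis, hsymm1]
    exact hker2 y hy y' hy' v hv
  rw [← hBpeq] at ht
  obtain ⟨y₁, hy₁, hyeq⟩ := (memB' _).1 ht
  have hDD : D *ᵥ (D⁻¹ *ᵥ (C v *ᵥ (D⁻¹ *ᵥ y))) = C v *ᵥ (D⁻¹ *ᵥ y) := by
    rw [Matrix.mulVec_mulVec, Matrix.mul_nonsing_inv _ hD, Matrix.one_mulVec]
  rw [← hDD, hyeq, Matrix.mulVec_mulVec, Matrix.mul_nonsing_inv _ hD, Matrix.one_mulVec]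
  exact hy₁

end Summit.ValiantsHypothesis.ValiantsHypothesis.Theorems.SymPencilLagrangianInvariant

end
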